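import Summits.KontsevichZagierPeriods.KontsevichZagierPeriods.Theorems.SoloInformedSegRep
import Summits.KontsevichZagierPeriods.KontsevichZagierPeriods.Theorems.SoloInformedPathHomotopy
import HarnessLib
import HarnessLib.Audit

/-!
# SoloInformed — moves on segment generators: addition, halving, inversion

Solo programme `solo-KontsevichZagierPeriods-informed`, session s112 (kernel project
«`SoloInformedKZPUpTo 1` unconditionally from the tree's kernel Baker theorem»), file 4.

Consequences of the homotopy lemma (`soloInformed_pathRep_sub_mem_relations_of_homotopy`) for the
segment generators `Seg(g, c) = soloInformedSegRep g c`: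

* **Addition** (`soloInformed_segRep_add_add_sub_mul_mem_relations`): if some `u ∈ ℂ` has
  `Re u, Re(ua), Re(ub), Re(uab) > 0` (the four points `1, a, b, ab` lie in one open half-plane),
  then `Seg(g,a) + Seg(g,b) ≡ Seg(g,ab)`.  The homotopy runs from the straight path `L_{ab}` to the
  PRODUCT path `L_a · L_b` (whose logarithmic derivative is the sum of the two integrands); the
  intermediate paths are probability combinations of `1, a, b, ab`, hence never `0`.
* **Halving** (`soloInformed_segRep_sub_halving_mem_relations`): `Seg(g,c) ≡ Seg(2g, √c)` with the
  principal square root `soloInformedSqrt c = exp(Log c/2)` (`u = conj √c`).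
* **Inversion** (`soloInformed_segRep_inv_add_mem_relations`): `Seg(g,b⁻¹) + Seg(g,b) ≡ 0` for
  `Re b > 0` (`u = 1`).

References: M. Kontsevich, D. Zagier, *Periods* (2001), §1.2; this work (design memo s112).
-/

noncomputable section

open scoped BigOperators Polynomial ComplexConjugate
open MeasureTheory Set Filter
open Literature.ModelTheory.ExponentialFields
open Literature.NumberTheory.Transcendental Literature.NumberTheory.Transcendental.KZ

namespace Summit.KontsevichZagierPeriods.KontsevichZagierPeriods.Theorems

/-! ### Half-plane bookkeeping -/

/-- If `Re u > 0` and `Re(u z) > 0` then `z ∉ (−∞, 0]`. -/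
theorem soloInformed_mem_slitPlane_of_re_mul_pos {u z : ℂ} (hu : 0 < u.re)
    (h : 0 < (u * z).re) : z ∈ Complex.slitPlane := by
  rw [Complex.mem_slitPlane_iff]
  by_contra hcon
  push Not at hcon
  have : (u * z).re = u.re * z.re := by rw [Complex.mul_re, hcon.2]; ring
  rw [this] at h
  nlinarith [hcon.1]

/-! ### Quadratic path polynomials -/

/-- The path polynomial `1 + p s + q s²`. -/
def soloInformedQuadPoly (p q : ℂ) : ℂ[X] :=
  Polynomial.C 1 + Polynomial.C p * Polynomial.X + Polynomial.C q * Polynomial.X ^ 2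

/-- Its coefficients are algebraic when `p, q` are. -/
theorem soloInformed_quadPoly_coeff_isAlgebraic {p q : ℂ} (hp : IsAlgebraic ℚ p)
    (hq : IsAlgebraic ℚ q) (n : ℕ) : IsAlgebraic ℚ ((soloInformedQuadPoly p q).coeff n) := by
  simp only [soloInformedQuadPoly, Polynomial.coeff_add, Polynomial.coeff_C,
    Polynomial.coeff_C_mul_X, Polynomial.coeff_C_mul_X_pow]
  split_ifs <;>
    (refine IsAlgebraic.add (IsAlgebraic.add ?_ ?_) ?_ <;>
      first | exact isAlgebraic_one | exact isAlgebraic_zero | exact hp | exact hq)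

/-- Evaluation of the path polynomial. -/
theorem soloInformed_quadPoly_eval (p q z : ℂ) :
    (soloInformedQuadPoly p q).eval z = 1 + p * z + q * z ^ 2 := by
  simp [soloInformedQuadPoly]

/-- Evaluation of its derivative. -/
theorem soloInformed_quadPoly_derivative_eval (p q z : ℂ) :
    (soloInformedQuadPoly p q).derivative.eval z = p + 2 * q * z := by
  simp [soloInformedQuadPoly]
  ring

/-! ### Addition -/

/-- **Addition of segments.** If `1, a, b, ab` lie in a common open half-plane
`{z | Re(u z) > 0}` and `g, a, b` are algebraic, then `Seg(g,a) + Seg(g,b) − Seg(g,ab)` is a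
relation: homotopy from the straight path to `ab` to the product path `L_a L_b`.
[this work; Kontsevich–Zagier 2001, §1.2] -/
theorem soloInformed_segRep_add_add_sub_mul_mem_relations {g a b u : ℂ} (hg : IsAlgebraic ℚ g)
    (ha : IsAlgebraic ℚ a) (hb : IsAlgebraic ℚ b) (hu : 0 < u.re) (hua : 0 < (u * a).re)
    (hub : 0 < (u * b).re) (huab : 0 < (u * (a * b)).re) :
    of (soloInformedSegRep g a) + of (soloInformedSegRep g b) -
      of (soloInformedSegRep g (a * b)) ∈ relations := by
  have ha' := soloInformed_mem_slitPlane_of_re_mul_pos hu hua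
  have hb' := soloInformed_mem_slitPlane_of_re_mul_pos hu hub
  have hab' := soloInformed_mem_slitPlane_of_re_mul_pos hu huab
  have hadmA : SoloInformedSegAdm g a := ⟨hg, ha, ha'⟩
  have hadmB : SoloInformedSegAdm g b := ⟨hg, hb, hb'⟩
  have hadmAB : SoloInformedSegAdm g (a * b) := ⟨hg, ha.mul hb, hab'⟩
  -- the two paths
  set V₀ : ℂ[X] := soloInformedQuadPoly (a * b - 1) 0 with hV₀
  set V₁ : ℂ[X] := soloInformedQuadPoly (a + b - 2) ((a - 1) * (b - 1)) with hV₁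
  have he₀ : ∀ z, V₀.eval z = 1 + (a * b - 1) * z := fun z => by
    rw [hV₀, soloInformed_quadPoly_eval]; ring
  have he₁ : ∀ z, V₁.eval z = (1 + (a - 1) * z) * (1 + (b - 1) * z) := fun z => by
    rw [hV₁, soloInformed_quadPoly_eval]; ring
  have hd₀ : ∀ z, V₀.derivative.eval z = a * b - 1 := fun z => by
    rw [hV₀, soloInformed_quadPoly_derivative_eval]; ring
  have hd₁ : ∀ z, V₁.derivative.eval z =
      (a - 1) * (1 + (b - 1) * z) + (1 + (a - 1) * z) * (b - 1) := fun z => by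
    rw [hV₁, soloInformed_quadPoly_derivative_eval]; ring
  -- the straight homotopy stays in the half-plane
  have hH : ∀ s ∈ Icc (0 : ℝ) 1, ∀ t ∈ Icc (0 : ℝ) 1,
      (1 - (t : ℂ)) * V₀.eval (s : ℂ) + (t : ℂ) * V₁.eval (s : ℂ) ≠ 0 := by
    intro s hs t ht hzero
    have key : u * ((1 - (t : ℂ)) * V₀.eval (s : ℂ) + (t : ℂ) * V₁.eval (s : ℂ)) =
        (((1 - t) * (1 - s) + t * (1 - s) ^ 2 : ℝ) : ℂ) * u +
          ((t * s * (1 - s) : ℝ) : ℂ) * (u * a) + ((t * s * (1 - s) : ℝ) : ℂ) * (u * b) +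
          (((1 - t) * s + t * s ^ 2 : ℝ) : ℂ) * (u * (a * b)) := by
      rw [he₀, he₁]; push_cast; ring
    have hre := congrArg Complex.re key
    rw [hzero, mul_zero, Complex.zero_re] at hre
    simp only [Complex.add_re, Complex.re_ofReal_mul] at hre
    obtain ⟨hs0, hs1⟩ := hs
    obtain ⟨ht0, ht1⟩ := ht
    set m : ℝ := min (min u.re (u * a).re) (min (u * b).re (u * (a * b)).re) with hm
    have hm0 : 0 < m := lt_min (lt_min hu hua) (lt_min hub huab)
    have h1 : m ≤ u.re := (min_le_left _ _).trans (min_le_left _ _)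
    have h2 : m ≤ (u * a).re := (min_le_left _ _).trans (min_le_right _ _)
    have h3 : m ≤ (u * b).re := (min_le_right _ _).trans (min_le_left _ _)
    have h4 : m ≤ (u * (a * b)).re := (min_le_right _ _).trans (min_le_right _ _)
    have hw1 : 0 ≤ (1 - t) * (1 - s) + t * (1 - s) ^ 2 := by
      have := mul_nonneg (sub_nonneg.2 ht1) (sub_nonneg.2 hs1)
      have := mul_nonneg ht0 (sq_nonneg (1 - s))
      linarith
    have hw2 : 0 ≤ t * s * (1 - s) := mul_nonneg (mul_nonneg ht0 hs0) (sub_nonneg.2 hs1)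
    have hw4 : 0 ≤ (1 - t) * s + t * s ^ 2 := by
      have := mul_nonneg (sub_nonneg.2 ht1) hs0
      have := mul_nonneg ht0 (sq_nonneg s)
      linarith
    have hms : m * (((1 - t) * (1 - s) + t * (1 - s) ^ 2) + t * s * (1 - s) + t * s * (1 - s) +
        ((1 - t) * s + t * s ^ 2)) = m := by ring
    nlinarith [mul_nonneg hw1 (sub_nonneg.2 h1), mul_nonneg hw2 (sub_nonneg.2 h2),
      mul_nonneg hw2 (sub_nonneg.2 h3), mul_nonneg hw4 (sub_nonneg.2 h4)]
  -- the sum of the two segment integrands as one representation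
  have hI := soloInformed_isSemialgebraic_unitBand
  let R₁ : IntegralRep 1 := ⟨soloInformedUnitBand,
    fun y => soloInformedSegFun g a y + soloInformedSegFun g b y, hI,
    IsSemialgebraicFunOn.add_holds (soloInformed_isSemialgebraicFunOn_segFun hg ha ha')
      (soloInformed_isSemialgebraicFunOn_segFun hg hb hb'),
    ((soloInformed_continuousOn_segFun g ha').integrableOn_compact
      soloInformed_isCompact_unitBand).add
      ((soloInformed_continuousOn_segFun g hb').integrableOn_compact
        soloInformed_isCompact_unitBand)⟩
  -- the homotopy lemma
  have hH' : of R₁ - of (soloInformedSegRep g (a * b)) ∈ relations := by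
    refine soloInformed_pathRep_sub_mem_relations_of_homotopy hg
      (soloInformed_quadPoly_coeff_isAlgebraic ((ha.mul hb).sub isAlgebraic_one) isAlgebraic_zero)
      (soloInformed_quadPoly_coeff_isAlgebraic ((ha.add hb).sub
        (by simpa using isAlgebraic_nat (R := ℚ) (A := ℂ) 2))
        ((ha.sub isAlgebraic_one).mul (hb.sub isAlgebraic_one)))
      (by rw [he₀, he₁]; ring) (by rw [he₀, he₁]; ring) hH (soloInformedSegRep g (a * b)) R₁
      (soloInformed_segRep_domain _ _) rfl (fun y hy => ?_) (fun y hy => ?_)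
    · rw [soloInformed_segRep_integrand hadmAB, hd₀, he₀]
      rfl
    · have hLa := soloInformed_seg_ne_zero ha' (soloInformed_mem_unitBand.1 hy)
      have hLb := soloInformed_seg_ne_zero hb' (soloInformed_mem_unitBand.1 hy)
      show soloInformedSegFun g a y + soloInformedSegFun g b y = _
      rw [hd₁, he₁]
      unfold soloInformedSegFun
      rw [← Complex.add_re, ← mul_add, div_add_div _ _ hLa hLb]
  -- integrand additivity
  have hadd : of R₁ - of (soloInformedSegRep g a) - of (soloInformedSegRep g b) ∈ relations :=
    integrandAddRel_subset_relations ⟨1, R₁, soloInformedSegRep g a, soloInformedSegRep g b,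
      soloInformed_segRep_domain _ _, soloInformed_segRep_domain _ _, fun y _ => by
        show soloInformedSegFun g a y + soloInformedSegFun g b y = _
        simp only [Pi.add_apply, soloInformed_segRep_integrand hadmA,
          soloInformed_segRep_integrand hadmB], rfl⟩
  have := relations.sub_mem hH' hadd
  convert this using 1
  abel

/-! ### The principal square root -/

/-- The principal square root `√c = exp(Log c / 2)`. -/
def soloInformedSqrt (c : ℂ) : ℂ := Complex.exp (Complex.log c / 2)

/-- `√c · √c = c` (`c ≠ 0`). -/
theorem soloInformed_sqrt_mul_self {c : ℂ} (hc : c ≠ 0) :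
    soloInformedSqrt c * soloInformedSqrt c = c := by
  unfold soloInformedSqrt
  rw [← Complex.exp_add, add_halves, Complex.exp_log hc]

/-- The imaginary part of `Log c / 2` is `arg c / 2`. -/
theorem soloInformed_log_div_two_im (c : ℂ) : (Complex.log c / 2).im = c.arg / 2 := by
  rw [Complex.div_ofNat_im, Complex.log_im]

/-- `Log √c = Log c / 2`. -/
theorem soloInformed_log_sqrt (c : ℂ) :
    Complex.log (soloInformedSqrt c) = Complex.log c / 2 := by
  unfold soloInformedSqrt
  have h1 := Complex.neg_pi_lt_arg c
  have h2 := Complex.arg_le_pi c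
  apply Complex.log_exp
  · rw [soloInformed_log_div_two_im]; linarith [Real.pi_pos]
  · rw [soloInformed_log_div_two_im]; linarith [Real.pi_pos]

/-- `Re √c > 0` for `c ∉ (−∞,0]`. -/
theorem soloInformed_sqrt_re_pos {c : ℂ} (hc : c ∈ Complex.slitPlane) :
    0 < (soloInformedSqrt c).re := by
  unfold soloInformedSqrt
  rw [Complex.exp_re]
  have hne : c.arg ≠ Real.pi := (Complex.mem_slitPlane_iff_arg.1 hc).1
  have hlt : c.arg < Real.pi := lt_of_le_of_ne (Complex.arg_le_pi c) hne
  have hgt := Complex.neg_pi_lt_arg c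
  refine mul_pos (Real.exp_pos _) (Real.cos_pos_of_mem_Ioo ⟨?_, ?_⟩)
  · rw [soloInformed_log_div_two_im]; linarith
  · rw [soloInformed_log_div_two_im]; linarith

/-- `√c ≠ 0`. -/
theorem soloInformed_sqrt_ne_zero (c : ℂ) : soloInformedSqrt c ≠ 0 :=
  Complex.exp_ne_zero _

/-- `√c` is algebraic when `c ≠ 0` is. -/
theorem soloInformed_sqrt_isAlgebraic {c : ℂ} (hc : IsAlgebraic ℚ c) (hc0 : c ≠ 0) :
    IsAlgebraic ℚ (soloInformedSqrt c) :=
  IsAlgebraic.of_pow two_pos (by rw [pow_two, soloInformed_sqrt_mul_self hc0]; exact hc)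

/-- `|Im d| < Re d` as soon as `Re d > 0` and `Re d² > 0` (i.e. `|arg d| < π/4`). -/
theorem soloInformed_abs_im_lt_re {d : ℂ} (hd : 0 < d.re) (h : 0 < (d * d).re) :
    |d.im| < d.re := by
  rw [Complex.mul_re] at h
  exact abs_lt_of_sq_lt_sq (by nlinarith) hd.le

/-- The fourth root `⁴√c = √(√c)` of `c ∉ (−∞,0]` lies in the sector `|Im z| < Re z`. -/
theorem soloInformed_abs_im_lt_re_sqrt_sqrt {c : ℂ} (hc : c ∈ Complex.slitPlane) :
    |(soloInformedSqrt (soloInformedSqrt c)).im| < (soloInformedSqrt (soloInformedSqrt c)).re := by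
  refine soloInformed_abs_im_lt_re (soloInformed_sqrt_re_pos ?_) ?_
  · exact Complex.mem_slitPlane_iff.2 (Or.inl (soloInformed_sqrt_re_pos hc))
  · rw [soloInformed_sqrt_mul_self (soloInformed_sqrt_ne_zero c)]
    exact soloInformed_sqrt_re_pos hc

/-! ### Halving and inversion -/

/-- **Halving.** `Seg(g, c) − Seg(2g, √c)` is a relation (`g, c` algebraic, `c ∉ (−∞,0]`):
addition with `a = b = √c`, `u = conj √c`, plus linearity in `g`. [this work] -/
theorem soloInformed_segRep_sub_halving_mem_relations {g c : ℂ} (hg : IsAlgebraic ℚ g)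
    (hc : IsAlgebraic ℚ c) (hc' : c ∈ Complex.slitPlane) :
    of (soloInformedSegRep g c) - of (soloInformedSegRep (2 * g) (soloInformedSqrt c)) ∈
      relations := by
  have hc0 := Complex.slitPlane_ne_zero hc'
  set d := soloInformedSqrt c with hd_def
  have hd : IsAlgebraic ℚ d := soloInformed_sqrt_isAlgebraic hc hc0
  have hdre : 0 < d.re := soloInformed_sqrt_re_pos hc'
  have hdd : d * d = c := soloInformed_sqrt_mul_self hc0
  have hd0 : d ≠ 0 := soloInformed_sqrt_ne_zero c
  have hu : 0 < (conj d).re := by rwa [Complex.conj_re]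
  have hud : 0 < (conj d * d).re := by
    rw [← Complex.normSq_eq_conj_mul_self, Complex.ofReal_re]
    exact Complex.normSq_pos.2 hd0
  have hudd : 0 < (conj d * (d * d)).re := by
    rw [← mul_assoc, ← Complex.normSq_eq_conj_mul_self, Complex.re_ofReal_mul]
    exact mul_pos (Complex.normSq_pos.2 hd0) hdre
  have hA := soloInformed_segRep_add_add_sub_mul_mem_relations hg hd hd hu hud hud hudd
  rw [hdd] at hA
  have hB := soloInformed_segRep_add_sub_mem_relations hg hg d
  rw [← two_mul] at hB
  have := relations.neg_mem (relations.add_mem hA hB)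
  convert this using 1
  abel

/-- **Inversion.** `Seg(g, b⁻¹) + Seg(g, b)` is a relation (`g, b` algebraic, `Re b > 0`):
addition with `a = b⁻¹`, `u = 1`, and `Seg(g, 1) ≡ 0`. [this work] -/
theorem soloInformed_segRep_inv_add_mem_relations {g b : ℂ} (hg : IsAlgebraic ℚ g)
    (hb : IsAlgebraic ℚ b) (hb' : 0 < b.re) :
    of (soloInformedSegRep g b⁻¹) + of (soloInformedSegRep g b) ∈ relations := by
  have hb0 : b ≠ 0 := fun h => by rw [h] at hb'; simp at hb'
  have h1 : 0 < ((1 : ℂ) * b⁻¹).re := by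
    rw [one_mul, Complex.inv_re]
    exact div_pos hb' (Complex.normSq_pos.2 hb0)
  have h2 : 0 < ((1 : ℂ) * b).re := by rwa [one_mul]
  have h3 : 0 < ((1 : ℂ) * (b⁻¹ * b)).re := by rw [inv_mul_cancel₀ hb0]; simp
  have hA := soloInformed_segRep_add_add_sub_mul_mem_relations hg hb.inv hb
    (by simp : 0 < (1 : ℂ).re) h1 h2 h3
  rw [inv_mul_cancel₀ hb0] at hA
  have := relations.add_mem hA (soloInformed_segRep_one_mem_relations g)
  simpa using this

/-- **Two halvings into the sector `|Im| < Re`.** For admissible `(g, c)` the fourth root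
`e = ⁴√c` is algebraic, satisfies `|Im e| < Re e`, `Log e = Log c / 4`, and
`Seg(g, c) − Seg(4g, e)` is a relation. [this work] -/
theorem soloInformed_segRep_sub_fourthRoot_mem_relations {g c : ℂ} (hg : IsAlgebraic ℚ g)
    (hc : IsAlgebraic ℚ c) (hc' : c ∈ Complex.slitPlane) :
    IsAlgebraic ℚ (soloInformedSqrt (soloInformedSqrt c)) ∧
    |(soloInformedSqrt (soloInformedSqrt c)).im| < (soloInformedSqrt (soloInformedSqrt c)).re ∧
    Complex.log (soloInformedSqrt (soloInformedSqrt c)) = Complex.log c / 4 ∧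
    of (soloInformedSegRep g c) -
      of (soloInformedSegRep (4 * g) (soloInformedSqrt (soloInformedSqrt c))) ∈ relations := by
  have hc0 := Complex.slitPlane_ne_zero hc'
  have hd : IsAlgebraic ℚ (soloInformedSqrt c) := soloInformed_sqrt_isAlgebraic hc hc0
  have hd' : soloInformedSqrt c ∈ Complex.slitPlane :=
    Complex.mem_slitPlane_iff.2 (Or.inl (soloInformed_sqrt_re_pos hc'))
  refine ⟨soloInformed_sqrt_isAlgebraic hd (soloInformed_sqrt_ne_zero c),
    soloInformed_abs_im_lt_re_sqrt_sqrt hc', ?_, ?_⟩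
  · rw [soloInformed_log_sqrt, soloInformed_log_sqrt]; ring
  · have h1 := soloInformed_segRep_sub_halving_mem_relations hg hc hc'
    have h2 := soloInformed_segRep_sub_halving_mem_relations
      ((by simpa using isAlgebraic_nat (R := ℚ) (A := ℂ) 2 : IsAlgebraic ℚ (2 : ℂ)).mul hg) hd hd'
    have h3 : (2 : ℂ) * (2 * g) = 4 * g := by ring
    rw [h3] at h2
    have := relations.add_mem h1 h2
    convert this using 1
    abel

end Summit.KontsevichZagierPeriods.KontsevichZagierPeriods.Theorems
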